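import Mathlib
import Literature.NumberTheory.Transcendental.PeriodConjecture
import Summits.KontsevichZagierPeriods.KontsevichZagierPeriods.Theses.InverseLandau

/-!
# `TateLifting`, line `Sketch`, stub `stub_genLifting` — the generation residue

Crux stmt-KontsevichZagierPeriods-9129 (`Summit.KontsevichZagierPeriods.KontsevichZagierPeriods.Theses.InverseLandau.TateLifting`).
`GenLifting : ∀ c, KZ.eval c = 0 → c ∈ KZ.relations ⊔ closure 𝒢` (𝒢 = generic fibres) is the
conjecture-grade residue of the line; like the crux it follows from the kernel form of Conjecture 1
(`Literature.NumberTheory.Transcendental.KZKernelConjecture`) with the EMPTY fibre combination. This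
file records the two conditional implications (named-fact hypotheses; CONDITIONAL results).
-/

noncomputable section

namespace Summit.KontsevichZagierPeriods.InverseLandau

open Literature.NumberTheory.Transcendental

/-- `KZKernelConjecture → GenLifting` (the generic-fibre summand is not even needed).
[cite: KontsevichZagier2001, §1.2] -/
theorem tateLifting_genLifting_of_kzKernelConjecture (hK : KZKernelConjecture) :
    ∀ c : KZ.FormalRep, KZ.eval c = 0 → c ∈ KZ.relations ⊔ AddSubgroup.closure
      {d : KZ.FormalRep | ∃ (n k : ℕ) (P Q : MvPolynomial (Fin (n + k)) ℚ) (U : Set (Fin k → ℝ))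
          (γ : ℝ → (Fin k → ℝ)) (a : Fin k → ℝ) (r : KZ.IntegralRep n),
        IsOpen U ∧ ContinuousOn γ (Set.Icc 0 1) ∧ γ 0 = 0 ∧ γ 1 = a ∧
        (∀ t ∈ Set.Icc (0 : ℝ) 1, γ t ∈ U) ∧
        (∃ c₀ : ℚ, c₀ ≠ 0 ∧ ∀ z : Fin n → ℝ,
          MvPolynomial.aeval (Fin.append z (0 : Fin k → ℝ)) Q = (c₀ : ℝ)) ∧
        (∀ (z : Fin n → ℝ) (u : Fin k → ℝ), (∀ i, z i ∈ Set.Icc (0 : ℝ) 1) → u ∈ U →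
          MvPolynomial.aeval (Fin.append z u) Q ≠ 0) ∧
        (∀ u ∈ U, ∫ z in Set.pi Set.univ (fun _ : Fin n => Set.Ioo (0 : ℝ) 1),
          MvPolynomial.aeval (Fin.append z u) P / MvPolynomial.aeval (Fin.append z u) Q = 0) ∧
        (∀ j, IsAlgebraic ℚ (a j)) ∧
        r.domain = Set.pi Set.univ (fun _ : Fin n => Set.Ioo (0 : ℝ) 1) ∧
        Set.EqOn r.integrand (fun z => MvPolynomial.aeval (Fin.append z a) P /
          MvPolynomial.aeval (Fin.append z a) Q) r.domain ∧
        d = KZ.of r} :=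
  fun c hc => AddSubgroup.mem_sup_left (hK c hc)

/-- `KZKernelConjecture → TateLifting`: the crux is implied by the kernel form of Conjecture 1 with
the empty fibre combination (as the route's thesis says). [cite: KontsevichZagier2001, §1.2] -/
theorem TateLifting_of_kzKernelConjecture (hK : KZKernelConjecture) :
    Summit.KontsevichZagierPeriods.KontsevichZagierPeriods.Theses.InverseLandau.TateLifting :=
  fun c hc => AddSubgroup.mem_sup_left (hK c hc)

end Summit.KontsevichZagierPeriods.InverseLandau

end
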